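import Summits.AtomisticToContinuum.BoseEinsteinCondensation.Theorems.InfraredMinimumUncertainty.Negative.FreeDensityWave

/-!
# Negative lemmas for crux `InfraredMinimumUncertainty` (stmt-AtomisticToContinuum-11784) — III:
# the Bragg peak, the energy and `Π_{e₀}` of the free density wave

Supports (does not close) stmt-AtomisticToContinuum-11784 (route `BECConjugateDomination`).
Importable form of §W (second half) of `Cruxes/InfraredMinimumUncertainty/Disproof.lean`
(generation 1):

* `integral_cos_mul_norm_sq_waveFun` (`∫ cos θ(xⱼ)|Ψ|² = 2ε/(1+2ε²)`),
  `structureFactor_waveState_ge`: **`S_{e₀} ≥ N · 4ε²/(1+2ε²)²`** (a Bragg peak, from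
  `|Z|² ≥ (Re Z)²` and the weighted Jensen inequality);
* `periodicEnergy_waveState_le`: **`E ≤ 16π²ε²N/L²`** for the free gas (`v ≡ 0`);
* `piProd` (`Π_m = N·ν_m·S_m` over the landed vocabulary) and `pi_waveState_ge`:
  **`Π_{e₀} ≥ 2ε⁴N²`** for `ε² ≤ 1/16`.
-/

noncomputable section

open MeasureTheory Filter Set
open scoped ENNReal NNReal Topology ComplexConjugate BigOperators

namespace Summit.AtomisticToContinuum.BoseEinsteinCondensation.Theorems.InfraredMinimumUncertainty.Negative

open Literature.MathematicalPhysics.QuantumManyBody.BoseGas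
open Summit.AtomisticToContinuum.BoseEinsteinCondensation.Theses.BECConjugateDomination
open Summit.AtomisticToContinuum.BoseEinsteinCondensation.Cruxes.InfraredMinimumUncertainty.FisherGaussianDensityMode
open Summit.AtomisticToContinuum.BoseEinsteinCondensation.Theorems.GaussianDominationCan.Negative
  (prodFun contDiff_prodFun continuous_prodFun prodFun_periodic prodFun_const_symm nnnorm_sq_prodFun
    lintegral_nnnorm_sq_prodFun fderiv_prodFun kineticDensity_prodFun lintegral_prod_erase
    periodicInteraction_zero lintegral_cellN_prod lintegral_cell_const volume_real_cell)
open Summit.AtomisticToContinuum.BoseEinsteinCondensation.Theorems.StaticResponseBound.Negative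
  (arg arg_intSMul re_cellWave integral_cell_cos_arg integral_cell_const phiMode continuous_arg
    contDiff_arg continuous_phiMode contDiff_phiMode arg_add_single phiMode_periodic phiMode_pos
    integral_cell_trig_combo integral_cell_phiMode_sq integral_cell_cos_mul_phiMode_sq
    isFiniteMeasure_restrict_cell argCLM argCLM_apply argCLM_single hasFDerivAt_phiMode
    isRepulsiveFiniteRange_zero integral_norm_sq_eq_one)
open Summit.AtomisticToContinuum.BoseEinsteinCondensation.Theorems.CorrectorClosure.Negative
  (e0 e0_ne_zero sideLength_succ_pos)

section Wave

variable {L : ℝ} {ε : ℝ} {n : ℕ}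

/-- The first moment of the density mode in the density wave:
`∫ cos θ(xⱼ) |Ψ|² = 2ε/(1 + 2ε²)` for every particle `j`. [folklore] -/
theorem integral_cos_mul_norm_sq_waveFun (hL : 0 < L) (hε : |ε| < 1 / 2) (j : Fin (n + 1)) :
    ∫ X in cellN (n + 1) L, Real.cos (arg L e0 (X j)) * ‖waveFun n L ε X‖ ^ 2 =
      2 * ε / (1 + 2 * ε ^ 2) := by
  classical
  simp_rw [norm_sq_waveFun hL hε]
  set F : Fin (n + 1) → Space → ℝ := fun i x =>
    if i = j then Real.cos (arg L e0 x) * waveFactor L ε x ^ 2 else waveFactor L ε x ^ 2 with hF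
  have hpt : ∀ X : Config (n + 1), Real.cos (arg L e0 (X j)) * ∏ i, waveFactor L ε (X i) ^ 2 =
      ∏ i, F i (X i) := by
    intro X
    rw [← Finset.mul_prod_erase Finset.univ (fun i => waveFactor L ε (X i) ^ 2) (Finset.mem_univ j),
      ← Finset.mul_prod_erase Finset.univ (fun i => F i (X i)) (Finset.mem_univ j)]
    have hFj : F j (X j) = Real.cos (arg L e0 (X j)) * waveFactor L ε (X j) ^ 2 := by
      simp [hF]
    have hFi : ∀ i ∈ Finset.univ.erase j, F i (X i) = waveFactor L ε (X i) ^ 2 := fun i hi => by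
      simp [hF, Finset.ne_of_mem_erase hi]
    rw [hFj, Finset.prod_congr rfl hFi, mul_assoc]
  simp_rw [hpt]
  rw [integral_cellN_prod_real F,
    ← Finset.mul_prod_erase Finset.univ (fun i => ∫ x in cell L, F i x) (Finset.mem_univ j)]
  have hIj : ∫ x in cell L, F j x = 2 * ε / (1 + 2 * ε ^ 2) := by
    simp only [hF, if_true]
    exact integral_cell_cos_mul_waveFactor_sq hL ε
  have hIi : ∀ i ∈ Finset.univ.erase j, ∫ x in cell L, F i x = 1 := fun i hi => by
    simp only [hF, if_neg (Finset.ne_of_mem_erase hi)]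
    exact integral_cell_waveFactor_sq hL ε
  rw [hIj, Finset.prod_eq_one hIi, mul_one]

/-- **The structure factor of the density wave has a Bragg peak**:
`S_{e₀} ≥ N · 4ε²/(1 + 2ε²)²` (from `|Z|² ≥ (Re Z)²` and Jensen). [folklore] -/
theorem structureFactor_waveState_ge (hL : 0 < L) (hε : |ε| < 1 / 2) :
    ((n : ℝ) + 1) * (2 * ε / (1 + 2 * ε ^ 2)) ^ 2 ≤ structureFactor n L (waveState n hL ε) e0 := by
  have hN : (0 : ℝ) < (n : ℝ) + 1 := by positivity
  refine le_of_mul_le_mul_left ?_ hN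
  rw [mul_structureFactor_eq]
  simp only [waveState_ψ]
  -- `Re Z = ∑ cos θ(xⱼ)`
  set f : Config (n + 1) → ℝ := fun X => ∑ j, Real.cos (arg L e0 (X j)) with hf
  have hfcont : Continuous f := by rw [hf]; fun_prop
  have hZ : Continuous fun X : Config (n + 1) => densityMode (n + 1) L e0 X := by
    unfold densityMode; fun_prop
  have hre : ∀ X, (densityMode (n + 1) L e0 X).re = f X := by
    intro X
    simp [densityMode, Complex.re_sum, re_cellWave, hf]
  -- first moment: `∫ f |Ψ|² = N · 2ε/(1+2ε²)`
  have hmom : ∫ X in cellN (n + 1) L, f X * ‖waveFun n L ε X‖ ^ 2 =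
      ((n : ℝ) + 1) * (2 * ε / (1 + 2 * ε ^ 2)) := by
    simp only [hf, Finset.sum_mul]
    rw [integral_finsetSum _ fun j _ => ?_]
    · simp only [integral_cos_mul_norm_sq_waveFun hL hε, Finset.sum_const, Finset.card_univ,
        Fintype.card_fin, nsmul_eq_mul, Nat.cast_add, Nat.cast_one]
    · exact integrableOn_cellN (Continuous.mul (by fun_prop)
        (((contDiff_prodFun fun _ => contDiff_waveFactorC L ε).continuous.norm).pow 2)) L
  -- Jensen and `|Z|² ≥ (Re Z)²`
  have hJ := sq_integral_le_integral_sq (L := L) hfcont (waveState n hL ε)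
  simp only [waveState_ψ] at hJ
  rw [hmom] at hJ
  have hw : Continuous fun X => ‖waveFun n L ε X‖ ^ 2 :=
    (((contDiff_prodFun fun _ => contDiff_waveFactorC L ε).continuous.norm).pow 2)
  have hmono : ∫ X in cellN (n + 1) L, f X ^ 2 * ‖waveFun n L ε X‖ ^ 2 ≤
      ∫ X in cellN (n + 1) L, ‖densityMode (n + 1) L e0 X‖ ^ 2 * ‖waveFun n L ε X‖ ^ 2 := by
    refine integral_mono (integrableOn_cellN ((hfcont.pow 2).mul hw) L)
      (integrableOn_cellN (((hZ.norm).pow 2).mul hw) L) fun X => ?_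
    refine mul_le_mul_of_nonneg_right ?_ (sq_nonneg _)
    rw [← hre, sq_le_sq, abs_norm]
    exact Complex.abs_re_le_norm _
  calc ((n : ℝ) + 1) * (((n : ℝ) + 1) * (2 * ε / (1 + 2 * ε ^ 2)) ^ 2)
      = (((n : ℝ) + 1) * (2 * ε / (1 + 2 * ε ^ 2))) ^ 2 := by ring
    _ ≤ _ := hJ.trans hmono

/-- **Energy of the density wave** (free gas): `E ≤ 16π²ε²N/L²` (exactly `8π²ε²N/((1+2ε²)L²)`). [folklore] -/
theorem periodicEnergy_waveState_le (hL : 0 < L) :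
    periodicEnergy 0 (waveState n hL ε) ≤
      ENNReal.ofReal (16 * Real.pi ^ 2 * ε ^ 2 * ((n : ℝ) + 1) / L ^ 2) := by
  unfold periodicEnergy
  simp only [periodicInteraction_zero, zero_mul, add_zero, waveState_ψ]
  unfold waveFun
  have hdiff : ∀ _i : Fin (n + 1), Differentiable ℝ (waveFactorC L ε) := fun _ =>
    (contDiff_waveFactorC L ε).differentiable one_ne_zero
  simp_rw [kineticDensity_prodFun hdiff]
  set D : ℝ := cnorm L ε ^ 2 * (16 * Real.pi ^ 2 * ε ^ 2 / L ^ 2) with hD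
  have hD0 : 0 ≤ D := by positivity
  have hF : Measurable fun x => ((‖waveFactorC L ε x‖₊ : ℝ≥0∞) ^ 2) :=
    (continuous_waveFactorC L ε).measurable.nnnorm.coe_nnreal_ennreal.pow_const _
  have hI : ∫⁻ x in cell L, ((‖waveFactorC L ε x‖₊ : ℝ≥0∞) ^ 2) = 1 :=
    lintegral_nnnorm_sq_waveFactorC hL ε
  -- pointwise bound of each summand, then integrate
  have hpt : ∀ X : Config (n + 1),
      (∑ i, (∏ j ∈ Finset.univ.erase i, ((‖waveFactorC L ε (X j)‖₊ : ℝ≥0∞) ^ 2)) *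
        ∑ k : Fin 3, ((‖fderiv ℝ (waveFactorC L ε) (X i) (EuclideanSpace.single k 1)‖₊ : ℝ≥0∞) ^ 2)) ≤
      ∑ i, ENNReal.ofReal D * ∏ j ∈ Finset.univ.erase i, ((‖waveFactorC L ε (X j)‖₊ : ℝ≥0∞) ^ 2) :=
    fun X => Finset.sum_le_sum fun i _ => by
      rw [mul_comm]
      exact mul_le_mul' (sum_nnnorm_sq_fderiv_waveFactorC_le hL ε (X i)) le_rfl
  have hmeas : ∀ i : Fin (n + 1), Measurable (fun X : Config (n + 1) =>
      ENNReal.ofReal D * ∏ j ∈ Finset.univ.erase i, ((‖waveFactorC L ε (X j)‖₊ : ℝ≥0∞) ^ 2)) :=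
    fun i => measurable_const.mul (Finset.measurable_prod _ fun j _ => hF.comp (measurable_pi_apply j))
  calc ∫⁻ X in cellN (n + 1) L, ∑ i, (∏ j ∈ Finset.univ.erase i,
          ((‖waveFactorC L ε (X j)‖₊ : ℝ≥0∞) ^ 2)) *
          ∑ k : Fin 3, ((‖fderiv ℝ (waveFactorC L ε) (X i) (EuclideanSpace.single k 1)‖₊ : ℝ≥0∞) ^ 2)
      ≤ ∫⁻ X in cellN (n + 1) L, ∑ i, ENNReal.ofReal D *
          ∏ j ∈ Finset.univ.erase i, ((‖waveFactorC L ε (X j)‖₊ : ℝ≥0∞) ^ 2) := lintegral_mono hpt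
    _ = ∑ i : Fin (n + 1), ENNReal.ofReal D * (ENNReal.ofReal L ^ 3 *
          ∏ _j ∈ Finset.univ.erase i, ∫⁻ x in cell L, ((‖waveFactorC L ε x‖₊ : ℝ≥0∞) ^ 2)) := by
        rw [lintegral_finsetSum _ fun i _ => hmeas i]
        refine Finset.sum_congr rfl fun i _ => ?_
        rw [lintegral_const_mul' _ _ ENNReal.ofReal_ne_top, lintegral_prod_erase i hF]
    _ = ∑ _i : Fin (n + 1), ENNReal.ofReal (D * L ^ 3) := by
        refine Finset.sum_congr rfl fun i _ => ?_
        simp only [hI, Finset.prod_const_one, mul_one]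
        rw [← ENNReal.ofReal_pow hL.le, ← ENNReal.ofReal_mul hD0]
    _ = ENNReal.ofReal (((n : ℝ) + 1) * (D * L ^ 3)) := by
        rw [Finset.sum_const, Finset.card_univ, Fintype.card_fin, nsmul_eq_mul,
          ← ENNReal.ofReal_natCast (n + 1), ← ENNReal.ofReal_mul (Nat.cast_nonneg _)]
        push_cast
        ring_nf
    _ ≤ ENNReal.ofReal (16 * Real.pi ^ 2 * ε ^ 2 * ((n : ℝ) + 1) / L ^ 2) := by
        refine ENNReal.ofReal_le_ofReal ?_
        have hc := cnorm_sq_mul_cube_le_one hL ε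
        have hL2 : 0 < L ^ 2 := by positivity
        rw [hD, show cnorm L ε ^ 2 * (16 * Real.pi ^ 2 * ε ^ 2 / L ^ 2) * L ^ 3 =
          (cnorm L ε ^ 2 * L ^ 3) * (16 * Real.pi ^ 2 * ε ^ 2 / L ^ 2) by ring]
        rw [show 16 * Real.pi ^ 2 * ε ^ 2 * ((n : ℝ) + 1) / L ^ 2 =
          ((n : ℝ) + 1) * (1 * (16 * Real.pi ^ 2 * ε ^ 2 / L ^ 2)) by ring]
        have h16 : 0 ≤ 16 * Real.pi ^ 2 * ε ^ 2 / L ^ 2 := by positivity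
        have hN : (0 : ℝ) ≤ (n : ℝ) + 1 := by positivity
        exact mul_le_mul_of_nonneg_left (mul_le_mul_of_nonneg_right hc h16) hN

/-- The crux's product `Π_m = N · ν_m · S_m` over the landed vocabulary. -/
def piProd (n : ℕ) (L : ℝ) (Ψ : PeriodicTrialState (n + 1) L) (m : Fin 3 → ℤ) : ℝ :=
  ((n : ℝ) + 1) * levyWeight n L Ψ m * structureFactor n L Ψ m

/-- **`Π_{e₀}` of the density wave**: `Π_{e₀} ≥ 2ε⁴N²` for `0 < ε ≤ 1/4`
(`ν ≥ (7/8)ε²`, `S ≥ (256/81)ε²N`). [folklore] -/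
theorem pi_waveState_ge (hL : 0 < L) (hε : |ε| < 1 / 2) (hε4 : ε ^ 2 ≤ 1 / 16) :
    2 * ε ^ 4 * ((n : ℝ) + 1) ^ 2 ≤ piProd n L (waveState n hL ε) e0 := by
  unfold piProd
  have hν := levyWeight_waveState_ge (n := n) hL hε
  have hS := structureFactor_waveState_ge (n := n) hL hε
  have hN : (0 : ℝ) < (n : ℝ) + 1 := by positivity
  have hν0 : 0 ≤ ε ^ 2 * (1 - 2 * ε ^ 2) := by nlinarith [sq_nonneg ε]
  have hS0 : 0 ≤ ((n : ℝ) + 1) * (2 * ε / (1 + 2 * ε ^ 2)) ^ 2 := by positivity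
  have hprod : ((n : ℝ) + 1) * (ε ^ 2 * (1 - 2 * ε ^ 2)) * (((n : ℝ) + 1) * (2 * ε / (1 + 2 * ε ^ 2)) ^ 2)
      ≤ ((n : ℝ) + 1) * levyWeight n L (waveState n hL ε) e0 *
          structureFactor n L (waveState n hL ε) e0 := by
    have h1 : ((n : ℝ) + 1) * (ε ^ 2 * (1 - 2 * ε ^ 2)) ≤
        ((n : ℝ) + 1) * levyWeight n L (waveState n hL ε) e0 := mul_le_mul_of_nonneg_left hν hN.le
    exact mul_le_mul h1 hS hS0 ((mul_nonneg hN.le hν0).trans h1)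
  refine le_trans ?_ hprod
  -- `2ε⁴N² ≤ N ε²(1−2ε²) · N · 4ε²/(1+2ε²)²` for `ε² ≤ 1/16`
  have hq : 0 < 1 + 2 * ε ^ 2 := by positivity
  rw [div_pow, show ((n : ℝ) + 1) * (ε ^ 2 * (1 - 2 * ε ^ 2)) *
      (((n : ℝ) + 1) * ((2 * ε) ^ 2 / (1 + 2 * ε ^ 2) ^ 2)) =
      ((n : ℝ) + 1) ^ 2 * ε ^ 4 * (4 * (1 - 2 * ε ^ 2) / (1 + 2 * ε ^ 2) ^ 2) by ring]
  have hkey : 2 ≤ 4 * (1 - 2 * ε ^ 2) / (1 + 2 * ε ^ 2) ^ 2 := by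
    rw [le_div_iff₀ (by positivity)]
    nlinarith [sq_nonneg ε, sq_nonneg (ε ^ 2)]
  have h0 : 0 ≤ ((n : ℝ) + 1) ^ 2 * ε ^ 4 := by positivity
  nlinarith

end Wave

end Summit.AtomisticToContinuum.BoseEinsteinCondensation.Theorems.InfraredMinimumUncertainty.Negative

end
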